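import Mathlib
import HarnessLib
import Summits.Ventures.LatticeQCDFlow.Exactness.StdGaussianRadial
import Summits.Ventures.LatticeQCDFlow.Exactness.SphereAxisCoordinates
import Summits.Ventures.LatticeQCDFlow.Exactness.UniformAngleCauchy

/-!
# A uniform angle parametrises the uniform law on the circle; the planar Gaussian in polar coordinates

HONEST FRAMING: exact (Metropolis-corrected) sampling algorithms for lattice gauge theory;
figures of merit are autocorrelation/cost numbers at stated couplings and volumes; no
continuum-physics claim.

Venture `LatticeQCDFlow` (cell pub-lqcd), topic `Exactness`, FANOUT row 9 (eng-latcore, the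
engine `latflow.core`).  NEW WORK of the cell over Mathlib (`polarCoord`,
`lintegral_comp_polarCoord_symm`, `AddCircle.lintegral_preimage`) and the tree's `RadialPolar.lean` /
`StdGaussianRadial.lean` (row 9: `uniformSphere`, `dirSphere`, Muller: `stdGaussian_map_dirSphere`)
and `SphereAxisCoordinates.lean` (row 7: `dirSphere_coe_sphere`).  Nothing is cited as a fact.
Printed counterparts, NAMED ONLY: Box–Muller 1958; Folland, *Real Analysis*, §2.7.

First half of the typing of the engine's AXIS draw (`csrc/latcore_template.c` `update_link`:
`cth = 2u−1, phi = 2πu′, sth = √(1−cth²)`, axis `(sth cos φ, sth sin φ, cth)`), which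
`SU2HeatBathSampler.lean` listed as NOT TYPED ("the engine's `(cos θ, φ)` chart").  This file
does the planar part:

* `E2`, `mk2 (x, y) ∈ E2`, `circlePt θ = (cos θ, sin θ) ∈ S¹`; `stdGaussian_two_eq_map_mk2` — the
  planar standard Gaussian is the image of `N(0,1) ⊗ N(0,1)`;
* **`lintegral_gaussian2_polar`** — the planar Gaussian in polar coordinates: for measurable `F`,
  `∫ F d(N⊗N) = ∫_{r>0} ∫_{θ∈(−π,π)} (2π)⁻¹ r e^{−r²/2} F(r cos θ, r sin θ) dθ dr`;
* **`lintegral_uniformSphere_two`** — ARC LENGTH: for measurable `G` on `S¹`,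
  `∫ G d(uniformSphere) = (2π)⁻¹ ∫_{(−π,π)} G(cos θ, sin θ) dθ` (Muller's direction of the planar
  Gaussian, read in polar coordinates; the radial factor integrates to one because `N⊗N` is a
  probability law — no Gaussian integral is evaluated);
* **`map_circlePt_unitLaw`** — the engine's longitude: `u ↦ (cos 2πu, sin 2πu)` pushes `unitLaw`
  to `uniformSphere` on `S¹` (periodicity moves `(0, 2π)` to `(−π, π)`);
* `lintegral_norm_stdGaussian_two` — the radius: `∫ h(‖y‖) dN(0,I₂) = ∫_{r>0} r e^{−r²/2} h(r) dr`
  (Rayleigh), used by `SU2AxisChart.lean` for the latitude.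
-/

namespace Summit.Ventures.LatticeQCDFlow.Exactness

open MeasureTheory Measure Metric Set Real ProbabilityTheory WithLp
open scoped ENNReal

/-! ## §1 The plane `E2`, points of the circle -/

/-- `ℝ²` as a Euclidean space. -/
abbrev E2 := EuclideanSpace ℝ (Fin 2)

/-- The point of `E2` with coordinates `(x, y)` (through Mathlib's `finTwoArrow`). -/
noncomputable def mk2 (p : ℝ × ℝ) : E2 := toLp 2 (MeasurableEquiv.finTwoArrow.symm p)

/-- First coordinate of `mk2`. -/
@[simp] theorem mk2_apply_zero (p : ℝ × ℝ) : mk2 p 0 = p.1 := by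
  simp [mk2, MeasurableEquiv.finTwoArrow]

/-- Second coordinate of `mk2`. -/
@[simp] theorem mk2_apply_one (p : ℝ × ℝ) : mk2 p 1 = p.2 := by
  simp [mk2, MeasurableEquiv.finTwoArrow]

/-- `mk2` is measurable. -/
theorem measurable_mk2 : Measurable mk2 :=
  (measurable_toLp 2 _).comp (MeasurableEquiv.measurable _)

/-- `‖mk2 (x, y)‖ = √(x² + y²)`. -/
theorem norm_mk2 (p : ℝ × ℝ) : ‖mk2 p‖ = Real.sqrt (p.1 ^ 2 + p.2 ^ 2) := by
  rw [EuclideanSpace.norm_eq, Fin.sum_univ_two]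
  simp [mk2_apply_zero, mk2_apply_one]

/-- `mk2` is linear in the radial parameter: `mk2 (r x, r y) = r • mk2 (x, y)`. -/
theorem mk2_smul (r : ℝ) (p : ℝ × ℝ) : mk2 (r * p.1, r * p.2) = r • mk2 p := by
  ext j
  fin_cases j <;> simp [mk2_apply_zero, mk2_apply_one]

/-- **The point `(cos θ, sin θ)` of the unit circle.** -/
noncomputable def circlePt (θ : ℝ) : sphere (0 : E2) 1 :=
  ⟨mk2 (Real.cos θ, Real.sin θ), by
    rw [mem_sphere_zero_iff_norm, norm_mk2, cos_sq_add_sin_sq, Real.sqrt_one]⟩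

/-- Coordinates of `circlePt`. -/
@[simp] theorem circlePt_coe (θ : ℝ) : (circlePt θ : E2) = mk2 (Real.cos θ, Real.sin θ) := rfl

/-- `circlePt` is measurable. -/
theorem measurable_circlePt : Measurable circlePt :=
  (measurable_mk2.comp (Real.measurable_cos.prodMk Real.measurable_sin)).subtype_mk

/-- `circlePt` is `2π`-periodic. -/
theorem circlePt_add_two_pi (θ : ℝ) : circlePt (θ + 2 * π) = circlePt θ := by
  apply Subtype.ext
  simp [Real.cos_add_two_pi, Real.sin_add_two_pi]

/-- In polar coordinates the direction is the angle: `dirSphere (mk2 (r cos θ, r sin θ)) = circlePt θ`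
for `r > 0`. -/
theorem dirSphere_mk2_polar {r : ℝ} (hr : 0 < r) (θ : ℝ) :
    dirSphere (mk2 (r * Real.cos θ, r * Real.sin θ)) = circlePt θ := by
  rw [show (r * Real.cos θ, r * Real.sin θ) = (r * (Real.cos θ, Real.sin θ).1, r * (Real.cos θ, Real.sin θ).2)
    from rfl, mk2_smul, dirSphere_smul hr, ← circlePt_coe, dirSphere_coe_sphere]

/-! ## §2 The planar standard Gaussian in polar coordinates -/

/-- The planar standard Gaussian is the image of `N(0,1) ⊗ N(0,1)` under `mk2`. -/
theorem stdGaussian_two_eq_map_mk2 :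
    stdGaussian E2 = ((gaussianReal 0 1).prod (gaussianReal 0 1)).map mk2 := by
  rw [← map_pi_eq_stdGaussian, ← (measurePreserving_finTwoArrow (gaussianReal 0 1)).symm
    MeasurableEquiv.finTwoArrow |>.map_eq, Measure.map_map (measurable_toLp 2 _) (MeasurableEquiv.measurable _)]
  rfl

/-- The product of two standard normal densities at `(r cos θ, r sin θ)` is `(2π)⁻¹ e^{−r²/2}`. -/
theorem gaussianPDF_mul_polar (r θ : ℝ) :
    gaussianPDF 0 1 (r * Real.cos θ) * gaussianPDF 0 1 (r * Real.sin θ) =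
      ENNReal.ofReal (Real.exp (-r ^ 2 / 2) / (2 * π)) := by
  simp only [gaussianPDF, gaussianPDFReal, NNReal.coe_one, mul_one, sub_zero]
  rw [← ENNReal.ofReal_mul (by positivity)]
  congr 1
  have hπ : 0 < 2 * π := by positivity
  rw [show (Real.sqrt (2 * π))⁻¹ * Real.exp (-(r * Real.cos θ) ^ 2 / 2) *
      ((Real.sqrt (2 * π))⁻¹ * Real.exp (-(r * Real.sin θ) ^ 2 / 2)) =
      ((Real.sqrt (2 * π))⁻¹ * (Real.sqrt (2 * π))⁻¹) *
        (Real.exp (-(r * Real.cos θ) ^ 2 / 2) * Real.exp (-(r * Real.sin θ) ^ 2 / 2)) by ring,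
    ← Real.exp_add, ← mul_inv, Real.mul_self_sqrt hπ.le]
  rw [show -(r * Real.cos θ) ^ 2 / 2 + -(r * Real.sin θ) ^ 2 / 2 =
      -r ^ 2 / 2 * (Real.cos θ ^ 2 + Real.sin θ ^ 2) by ring, cos_sq_add_sin_sq, mul_one]
  field_simp

/-- **The planar Gaussian in polar coordinates.**  For every measurable `F ≥ 0`,
`∫ F d(N(0,1) ⊗ N(0,1)) = ∫_{r>0} ∫_{θ ∈ (−π,π)} (2π)⁻¹ r e^{−r²/2} F(r cos θ, r sin θ) dθ dr`. -/
theorem lintegral_gaussian2_polar {F : ℝ × ℝ → ℝ≥0∞} (hF : Measurable F) :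
    ∫⁻ p, F p ∂((gaussianReal 0 1).prod (gaussianReal 0 1)) =
      ∫⁻ r in Ioi 0, ∫⁻ θ in Ioo (-π) π,
        ENNReal.ofReal (r * Real.exp (-r ^ 2 / 2) / (2 * π)) * F (r * Real.cos θ, r * Real.sin θ) := by
  have hpdf : Measurable (gaussianPDF 0 1) := measurable_gaussianPDF 0 1
  rw [gaussianReal_of_var_ne_zero 0 one_ne_zero, prod_withDensity_left hpdf, prod_withDensity_right hpdf,
    lintegral_withDensity_eq_lintegral_mul _ (f := fun z : ℝ × ℝ => gaussianPDF 0 1 z.1)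
      (hpdf.comp measurable_fst) hF,
    lintegral_withDensity_eq_lintegral_mul _ (f := fun z : ℝ × ℝ => gaussianPDF 0 1 z.2)
      (g := (fun z : ℝ × ℝ => gaussianPDF 0 1 z.1) * F)
      (hpdf.comp measurable_snd) ((hpdf.comp measurable_fst).mul hF),
    ← Measure.volume_eq_prod, ← lintegral_comp_polarCoord_symm,
    show polarCoord.target = Ioi (0 : ℝ) ×ˢ Ioo (-π) π from rfl, Measure.volume_eq_prod,
    setLIntegral_prod _ (Measurable.aemeasurable ?_)]
  · refine setLIntegral_congr_fun measurableSet_Ioi fun r hr => ?_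
    refine setLIntegral_congr_fun measurableSet_Ioo fun θ _ => ?_
    simp only [polarCoord_symm_apply, Pi.mul_apply, smul_eq_mul]
    rw [← mul_assoc (gaussianPDF 0 1 _), mul_comm (gaussianPDF 0 1 (r * Real.sin θ)), gaussianPDF_mul_polar,
      ← mul_assoc, ← ENNReal.ofReal_mul (le_of_lt hr)]
    congr 2
    field_simp
  · exact (ENNReal.measurable_ofReal.comp measurable_fst).smul
      (((hpdf.comp measurable_snd).mul ((hpdf.comp measurable_fst).mul hF)).comp
        (by fun_prop : Measurable fun p : ℝ × ℝ => (p.1 * Real.cos p.2, p.1 * Real.sin p.2)))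

/-- The radial factor integrates to one: `∫_{r>0} r e^{−r²/2} dr = 1` (as the total mass of `N⊗N`). -/
theorem lintegral_Ioi_mul_exp_neg_sq :
    ∫⁻ r in Ioi 0, ENNReal.ofReal (r * Real.exp (-r ^ 2 / 2)) = 1 := by
  have h := lintegral_gaussian2_polar (F := fun _ => 1) measurable_const
  rw [lintegral_const, measure_univ, mul_one] at h
  have hθ : ∀ r ∈ Ioi (0 : ℝ), ∫⁻ θ in Ioo (-π) π, ENNReal.ofReal (r * Real.exp (-r ^ 2 / 2) / (2 * π)) * (1 : ℝ≥0∞) =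
      ENNReal.ofReal (r * Real.exp (-r ^ 2 / 2)) := by
    intro r hr
    have hr' : (0 : ℝ) < r := hr
    rw [mul_one, setLIntegral_const, Real.volume_Ioo, show π - -π = 2 * π by ring,
      ← ENNReal.ofReal_mul (by positivity)]
    congr 1
    field_simp
  rw [← setLIntegral_congr_fun measurableSet_Ioi hθ]
  exact h.symm

/-! ## §3 The uniform law on the circle is the law of a uniform angle -/

/-- **Arc length.**  For every measurable `G ≥ 0` on the unit circle,
`∫ G d(uniformSphere) = (2π)⁻¹ ∫_{(−π,π)} G(cos θ, sin θ) dθ`. -/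
theorem lintegral_uniformSphere_two {G : sphere (0 : E2) 1 → ℝ≥0∞} (hG : Measurable G) :
    ∫⁻ w, G w ∂(uniformSphere (volume : Measure E2)) =
      ∫⁻ θ in Ioo (-π) π, ENNReal.ofReal (1 / (2 * π)) * G (circlePt θ) := by
  rw [← stdGaussian_map_dirSphere (Fin 2), lintegral_map hG measurable_dirSphere, stdGaussian_two_eq_map_mk2,
    lintegral_map (f := fun y : E2 => G (dirSphere y)) (hG.comp measurable_dirSphere) measurable_mk2,
    lintegral_gaussian2_polar (F := fun p => G (dirSphere (mk2 p)))
      (hG.comp (measurable_dirSphere.comp measurable_mk2))]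
  have hinner : ∀ r ∈ Ioi (0 : ℝ), ∫⁻ θ in Ioo (-π) π, ENNReal.ofReal (r * Real.exp (-r ^ 2 / 2) / (2 * π)) *
      G (dirSphere (mk2 (r * Real.cos θ, r * Real.sin θ))) =
      ENNReal.ofReal (r * Real.exp (-r ^ 2 / 2)) *
        ∫⁻ θ in Ioo (-π) π, ENNReal.ofReal (1 / (2 * π)) * G (circlePt θ) := by
    intro r hr
    have hr' : (0 : ℝ) < r := hr
    rw [← lintegral_const_mul' _ _ ENNReal.ofReal_ne_top]
    refine setLIntegral_congr_fun measurableSet_Ioo fun θ _ => ?_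
    rw [dirSphere_mk2_polar hr', ← mul_assoc, ← ENNReal.ofReal_mul (by positivity)]
    congr 2
    field_simp
  rw [setLIntegral_congr_fun measurableSet_Ioi hinner,
    lintegral_mul_const _ (by fun_prop : Measurable fun r : ℝ => ENNReal.ofReal (r * Real.exp (-r ^ 2 / 2))),
    lintegral_Ioi_mul_exp_neg_sq, one_mul]

/-- Shifting the window of a `2π`-periodic integrand. -/
theorem lintegral_Ioc_periodic {g : ℝ → ℝ≥0∞} (hg : Function.Periodic g (2 * π)) (s t : ℝ) :
    ∫⁻ θ in Ioc s (s + 2 * π), g θ = ∫⁻ θ in Ioc t (t + 2 * π), g θ := by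
  haveI : Fact (0 < 2 * π) := ⟨by positivity⟩
  have h1 := AddCircle.lintegral_preimage (T := 2 * π) s hg.lift
  have h2 := AddCircle.lintegral_preimage (T := 2 * π) t hg.lift
  simp only [Function.Periodic.lift_coe] at h1 h2
  rw [h1, h2]

/-- **The engine's longitude draw is uniform on the circle.**  For every measurable `G ≥ 0`,
`∫ G(cos 2πu, sin 2πu) d unitLaw(u) = ∫ G d(uniformSphere)`. -/
theorem lintegral_circlePt_unitLaw {G : sphere (0 : E2) 1 → ℝ≥0∞} (hG : Measurable G) :
    ∫⁻ u, G (circlePt (2 * π * u)) ∂unitLaw = ∫⁻ w, G w ∂(uniformSphere (volume : Measure E2)) := by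
  have hπ : 0 < 2 * π := by positivity
  rw [lintegral_uniformSphere_two hG, lintegral_unitLaw]
  -- substitution `θ = 2πu`
  have himg : (fun u : ℝ => 2 * π * u) '' Ioo 0 1 = Ioo 0 (2 * π) := by
    ext θ
    constructor
    · rintro ⟨u, hu, rfl⟩; exact ⟨by nlinarith [hu.1, pi_pos], by nlinarith [hu.2, pi_pos]⟩
    · intro hθ
      exact ⟨θ / (2 * π), ⟨div_pos hθ.1 hπ, (div_lt_one hπ).mpr hθ.2⟩, mul_div_cancel₀ _ hπ.ne'⟩
  have hderiv : ∀ u ∈ Ioo (0 : ℝ) 1, HasDerivWithinAt (fun u : ℝ => 2 * π * u) (2 * π) (Ioo 0 1) u := by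
    intro u _
    simpa using ((hasDerivAt_id u).const_mul (2 * π)).hasDerivWithinAt
  have hinj : InjOn (fun u : ℝ => 2 * π * u) (Ioo 0 1) := (mul_right_injective₀ hπ.ne').injOn
  have hsub := lintegral_image_eq_lintegral_abs_deriv_mul measurableSet_Ioo hderiv hinj
    (fun θ => ENNReal.ofReal (1 / (2 * π)) * G (circlePt θ))
  rw [himg] at hsub
  have hpt : ∀ u : ℝ, ENNReal.ofReal |2 * π| * (ENNReal.ofReal (1 / (2 * π)) * G (circlePt (2 * π * u))) =
      G (circlePt (2 * π * u)) := by
    intro u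
    rw [← mul_assoc, ← ENNReal.ofReal_mul (abs_nonneg _), abs_of_pos hπ, mul_one_div_cancel hπ.ne',
      ENNReal.ofReal_one, one_mul]
  simp_rw [hpt] at hsub
  rw [← hsub, setLIntegral_congr Ioo_ae_eq_Ioc, setLIntegral_congr (Ioo_ae_eq_Ioc (a := -π) (b := π))]
  -- periodicity: the window `(0, 2π]` carries the same integral as `(−π, π]`
  have hper : Function.Periodic (fun θ => ENNReal.ofReal (1 / (2 * π)) * G (circlePt θ)) (2 * π) :=
    fun θ => by simp only [circlePt_add_two_pi]
  have h := lintegral_Ioc_periodic hper 0 (-π)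
  rw [zero_add, show -π + 2 * π = π by ring] at h
  exact h

/-- **As a law**: `u ↦ (cos 2πu, sin 2πu)` pushes `unitLaw` forward to the uniform probability on `S¹`. -/
theorem map_circlePt_unitLaw :
    unitLaw.map (fun u => circlePt (2 * π * u)) = uniformSphere (volume : Measure E2) := by
  have hm : Measurable fun u : ℝ => circlePt (2 * π * u) := measurable_circlePt.comp (by fun_prop)
  refine Measure.ext_of_lintegral _ fun G hG => ?_
  rw [lintegral_map hG hm, lintegral_circlePt_unitLaw hG]

/-! ## §4 The radius of the planar Gaussian (Rayleigh) -/

/-- **Rayleigh law of the radius**: for every measurable `h ≥ 0`,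
`∫ h(‖y‖) dN(0, I₂)(y) = ∫_{r>0} r e^{−r²/2} h(r) dr`. -/
theorem lintegral_norm_stdGaussian_two {h : ℝ → ℝ≥0∞} (hh : Measurable h) :
    ∫⁻ y, h ‖y‖ ∂(stdGaussian E2) = ∫⁻ r in Ioi 0, ENNReal.ofReal (r * Real.exp (-r ^ 2 / 2)) * h r := by
  rw [stdGaussian_two_eq_map_mk2, lintegral_map (f := fun y : E2 => h ‖y‖) (hh.comp measurable_norm) measurable_mk2,
    lintegral_gaussian2_polar (F := fun p => h ‖mk2 p‖) (hh.comp (measurable_mk2.norm))]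
  refine setLIntegral_congr_fun measurableSet_Ioi fun r hr => ?_
  have hr' : (0 : ℝ) < r := hr
  have hnorm : ∀ θ : ℝ, ‖mk2 (r * Real.cos θ, r * Real.sin θ)‖ = r := by
    intro θ
    rw [norm_mk2, show (r * Real.cos θ) ^ 2 + (r * Real.sin θ) ^ 2 = r ^ 2 * (Real.cos θ ^ 2 + Real.sin θ ^ 2)
      by ring, cos_sq_add_sin_sq, mul_one, Real.sqrt_sq hr'.le]
  simp_rw [hnorm]
  rw [setLIntegral_const, Real.volume_Ioo, show π - -π = 2 * π by ring, mul_comm _ (ENNReal.ofReal (2 * π)),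
    ← mul_assoc, ← ENNReal.ofReal_mul hπ0]
  · congr 2
    field_simp
where hπ0 : (0 : ℝ) ≤ 2 * π := by positivity

end Summit.Ventures.LatticeQCDFlow.Exactness
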